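import Mathlib
import Summits.ValiantsHypothesis.ValiantsHypothesis.Theorems.GeneratorObstructionsPowGenDegreeQPBlockCountGen
import Literature.Computability.AlgebraicComplexity.TableauPolynomial

/-!
# Route GeneratorObstructions — crux K2 `PowGenDegreeQP` (stmt-ValiantsHypothesis-11655), line
# `trace-side-regimes`: the explicit gadget tableau datum

Companion of `…PowGenDegreeQPTableauBridge` / `…GadgetEval` / `…BlockCountGen/Eval` (blueprint:
evidence memo `evidence-11655-leafhand3-g5.md`).  This file DEFINES the tableau datum of the
blueprint as an honest `TableauEval.TabM` (`gadgetTab k c hk hc x`), with all index bookkeeping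
proved (`boxColRow_lt`: every box lands in the diagram), so that the two remaining obligations of
the certificate are stated against a fixed object:
(1) the box map is a bijection (a `TabM.Frame`); (2) the valid signed count at the gadget is
`blockSum k ^ (2^c - 1)` (type preservation + factorisation).  With (1)+(2) the assembly
`canonicalGadgetGIT_gen ⟹ ¬ PowGenDegreeQP` is already written and kernel-checked modulo them
(skeleton `GadgetTableau.lean` attached as evidence on the item).

Conventions.  Column `n < 3k·2^c`: FULL if `n < 3k` (all `3c` rows), else of TYPE
`i = log₂(n / 3k)` (rows = positions `≥ 3i+1`, height `3c-3i-1`).  Row `r` of a column is position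
`3c-1-r` and carries the letter `x r` (the `r`-th largest letter).  Block-`j` letters: `A'_j` at
position `3j+3` (`3c-1` for `j = c-1`), `A_j` at `3j+1`, `B_j` at `3j-1` (`0` for `j = 0`); kinds
`0 = A'`, `1 = A`, `2 = B` as in `…BlockCountGen`.  Label `u < 3(2^c-1)`: `u = 3v + ℓ`, block
`j = log₂(v+1)`, copy `q = v+1-2^j`, D*-label `ℓ`.  Boxes of `(j,q,ℓ)`: index `s < 3k` ↦ triple column
`n = 3kq + s` (type `< j`), row = block-`j` letter of kind `(tripleLabNat k s)⁻¹ ℓ` (the box keeps its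
label; cf. `dstarTripleLab`); index `s = 3k + t` (`t < 2k`) ↦ type-`j` column
`n = 3k·2^j + 3kq + pairIdx ℓ t`, row = kind of `ℓ` in that pair column (`dstarPairLab`).
A Python mirror of these definitions (seat folder `calc/lean_mirror.py`) checks bijectivity for
`(k,c) ∈ {(1,1),(2,1),(1,2),(2,2),(1,3),(3,2)}` and the count `blockSum k ^ (2^c-1)` for `(1,1),(1,2)`.

Honest framing: definitions and index arithmetic; no stub, crux or summit is settled here;
`VP ≠ VNP` untouched. [folklore]
-/

namespace Summit.ValiantsHypothesis.ValiantsHypothesis.Theorems.GeneratorObstructions.PowGenDegreeQP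

open Literature.Computability.AlgebraicComplexity Literature.Computability.AlgebraicComplexity.TableauEval

-- `Summit.ValiantsHypothesis.ValiantsHypothesis.…` is the tree's mandated single-conjunct layout.
set_option linter.dupNamespace false

noncomputable section

/-! ## §1 Index bookkeeping -/

/-- Height of column `n`: `3c` for the `3k` full columns, `3c - 3i - 1` for a type-`i` column
(`3k·2^i ≤ n < 3k·2^{i+1}`, `i = log₂ (n / 3k)`). [folklore] -/
def colHeight (k c : ℕ) (n : ℕ) : ℕ :=
  if n < 3 * k then 3 * c else 3 * c - 3 * Nat.log 2 (n / (3 * k)) - 1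

/-- Position (in the `3c` gadget letters, `0` = smallest) of the block-`j` letter of kind
`r` (`0 = A'`, `1 = A`, `2 = B`). [folklore] -/
def letterPos (c : ℕ) (j : ℕ) (r : Fin 3) : ℕ :=
  if r = 0 then (if j = c - 1 then 3 * c - 1 else 3 * j + 3)
  else if r = 1 then 3 * j + 1
  else (if j = 0 then 0 else 3 * j - 1)

/-- Row index (from the top) of the block-`j` letter of kind `r`: `3c - 1 - position`. [folklore] -/
def letterRow (c : ℕ) (j : ℕ) (r : Fin 3) : ℕ := 3 * c - 1 - letterPos c j r

/-- Block of label `u = 3v + ℓ`: `log₂ (v+1)`. [folklore] -/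
def labBlock (u : ℕ) : ℕ := Nat.log 2 (u / 3 + 1)
/-- Copy of label `u`: `v + 1 - 2^{block}`. [folklore] -/
def labCopy (u : ℕ) : ℕ := u / 3 + 1 - 2 ^ labBlock u
/-- D*-label of label `u`: `u % 3`. [folklore] -/
def labLab (u : ℕ) : Fin 3 := ⟨u % 3, Nat.mod_lt _ (by norm_num)⟩

/-- The `t`-th pair column of `D*` containing the D*-label `ℓ` (`t < 2k`): label `0` sits in pair
columns `[0,2k)`, label `1` in `[0,k) ∪ [2k,3k)`, label `2` in `[k,3k)`. [folklore] -/
def pairIdx (k : ℕ) (ℓ : Fin 3) (t : ℕ) : ℕ :=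
  if ℓ = 0 then t else if ℓ = 1 then (if t < k then t else t + k) else t + k

/-- `dstarTripleLab` on natural-number indices. [folklore] -/
def tripleLabNat (k i : ℕ) : Equiv.Perm (Fin 3) :=
  if i < k then finRotate 3 else if i < 2 * k then Equiv.swap 1 2 else 1

/-- `dstarPairLab` on natural-number indices. [folklore] -/
def pairLabNat (k i : ℕ) : Fin 2 → Fin 3 :=
  if i < k then ![1, 0] else if i < 2 * k then ![2, 0] else ![2, 1]

/-- Kind (`0 = A'`, `1 = A`) of D*-label `ℓ` in pair column `i`. [folklore] -/
def pairKind (k : ℕ) (ℓ : Fin 3) (i : ℕ) : Fin 3 :=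
  if pairLabNat k i 0 = ℓ then 0 else 1

/-- Column and row of the `s`-th box of label `u` (as naturals). [folklore] -/
def boxColRow (k c : ℕ) (u s : ℕ) : ℕ × ℕ :=
  if s < 3 * k then
    (3 * k * labCopy u + s,
      letterRow c (labBlock u) ((tripleLabNat k s)⁻¹ (labLab u)))
  else
    (3 * k * 2 ^ labBlock u + 3 * k * labCopy u + pairIdx k (labLab u) (s - 3 * k),
      letterRow c (labBlock u) (pairKind k (labLab u) (pairIdx k (labLab u) (s - 3 * k))))

/-- Letter positions lie below `3c` (block `j < c`). [folklore] -/
theorem letterPos_le {c j : ℕ} (hj : j < c) (r : Fin 3) : letterPos c j r ≤ 3 * c - 1 := by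
  unfold letterPos; split_ifs <;> omega

/-- Letter positions of block `j` are at least `3j - 1`. [folklore] -/
theorem le_letterPos (c j : ℕ) (r : Fin 3) : 3 * j ≤ letterPos c j r + 1 := by
  unfold letterPos; split_ifs <;> omega

/-- The `A'`/`A` letters of block `j` sit at positions `≥ 3j + 1`. [folklore] -/
theorem letterPos_ge_of_ne_two {c j : ℕ} (hj : j < c) {r : Fin 3} (hr : r ≠ 2) :
    3 * j + 1 ≤ letterPos c j r := by
  have hr' : r = 0 ∨ r = 1 := by
    fin_cases r
    · exact Or.inl rfl
    · exact Or.inr rfl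
    · exact absurd rfl hr
  rcases hr' with rfl | rfl
  · unfold letterPos
    rw [if_pos rfl]
    split_ifs <;> omega
  · unfold letterPos
    rw [if_neg (by decide), if_pos rfl]

/-- `pairKind` is an `A'`/`A` kind. [folklore] -/
theorem pairKind_ne_two (k : ℕ) (ℓ : Fin 3) (i : ℕ) : pairKind k ℓ i ≠ 2 := by
  unfold pairKind; split_ifs <;> decide

/-- `pairIdx` lands in `[0, 3k)` for `t < 2k`. [folklore] -/
theorem pairIdx_lt {k t : ℕ} (ht : t < 2 * k) (ℓ : Fin 3) : pairIdx k ℓ t < 3 * k := by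
  unfold pairIdx; split_ifs <;> omega

/-- Block and copy of a label `u < 3(2^c - 1)`: `j < c`, `q < 2^j`, and `2^j + q = u/3 + 1`. [folklore] -/
theorem labBlock_lt {c : ℕ} (u : Fin (3 * (2 ^ c - 1))) :
    labBlock u < c ∧ labCopy u < 2 ^ labBlock u ∧ 2 ^ labBlock u + labCopy u = u.val / 3 + 1 := by
  have hu := u.isLt
  have hv : u.val / 3 < 2 ^ c - 1 := by
    rw [Nat.div_lt_iff_lt_mul (by norm_num)]; linarith
  set v := u.val / 3 with hvdef
  have h1 : 2 ^ labBlock u ≤ v + 1 := Nat.pow_log_le_self 2 (by omega)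
  have h2 : v + 1 < 2 ^ (labBlock u + 1) := Nat.lt_pow_succ_log_self (by norm_num) _
  refine ⟨?_, ?_, ?_⟩
  · by_contra hge
    push Not at hge
    have : 2 ^ c ≤ 2 ^ labBlock u := Nat.pow_le_pow_right (by norm_num) hge
    omega
  · unfold labCopy
    rw [pow_succ] at h2
    omega
  · unfold labCopy
    omega

/-- The box map lands in the diagram (column `< 3k·2^c`, row `<` height). [folklore] -/
theorem boxColRow_lt (k c : ℕ) (hk : 1 ≤ k) (hc : 1 ≤ c) (u : Fin (3 * (2 ^ c - 1))) (s : Fin (5 * k)) :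
    (boxColRow k c u s).1 < 3 * k * 2 ^ c ∧
      (boxColRow k c u s).2 < colHeight k c (boxColRow k c u s).1 := by
  obtain ⟨hjc, hq, hjq⟩ := labBlock_lt u
  have hs := s.isLt
  have h2j : 2 ^ (labBlock u) < 2 ^ c := Nat.pow_lt_pow_right (by norm_num) hjc
  unfold boxColRow
  split_ifs with hs3
  · -- triple column `3kq + s`
    simp only
    have hcol : 3 * k * (labCopy u) + s < 3 * k * 2 ^ c := by nlinarith
    refine ⟨hcol, ?_⟩
    have hP := letterPos_le hjc ((tripleLabNat k s)⁻¹ (labLab u))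
    have hP' := le_letterPos c (labBlock u) ((tripleLabNat k s)⁻¹ (labLab u))
    unfold colHeight letterRow
    split_ifs with hn
    · omega
    · -- typed column: `(labCopy u) ≥ 1`, `(3kq+s)/(3k) = (labCopy u)`, `log₂ (labCopy u) ≤ (labBlock u) - 1`
      have hq0 : (labCopy u) ≠ 0 := by
        intro h0; apply hn; rw [h0]; omega
      have hdiv : (3 * k * (labCopy u) + s) / (3 * k) = (labCopy u) := by
        rw [show 3 * k * (labCopy u) + s = s + 3 * k * (labCopy u) by ring, Nat.add_mul_div_left _ _ (by omega),
          Nat.div_eq_of_lt hs3, zero_add]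
      rw [hdiv]
      have hlog : Nat.log 2 (labCopy u) < (labBlock u) := (Nat.log_lt_iff_lt_pow (by norm_num) hq0).mpr hq
      have hj1 : 1 ≤ (labBlock u) := by
        by_contra h0
        have : (labBlock u) = 0 := by omega
        rw [this] at hq; omega
      omega
  · -- pair column `3k·2^(labBlock u) + 3kq + pairIdx`
    simp only
    have ht : s.val - 3 * k < 2 * k := by omega
    have hi := pairIdx_lt ht (labLab u)
    have hcol : 3 * k * 2 ^ (labBlock u) + 3 * k * (labCopy u) + pairIdx k (labLab u) (s.val - 3 * k) < 3 * k * 2 ^ c := by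
      have : 2 ^ (labBlock u) + (labCopy u) + 1 ≤ 2 ^ c := by
        have : 2 ^ ((labBlock u) + 1) ≤ 2 ^ c := Nat.pow_le_pow_right (by norm_num) hjc
        rw [pow_succ] at this; omega
      nlinarith
    refine ⟨hcol, ?_⟩
    have hne := pairKind_ne_two k (labLab u) (pairIdx k (labLab u) (s.val - 3 * k))
    have hP := letterPos_ge_of_ne_two hjc hne
    have hP2 := letterPos_le hjc (pairKind k (labLab u) (pairIdx k (labLab u) (s.val - 3 * k)))
    unfold colHeight letterRow
    have hn : ¬ 3 * k * 2 ^ (labBlock u) + 3 * k * (labCopy u) + pairIdx k (labLab u) (s.val - 3 * k) < 3 * k := by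
      have : 1 ≤ 2 ^ (labBlock u) := Nat.one_le_two_pow
      nlinarith
    rw [if_neg hn]
    have hdiv : (3 * k * 2 ^ (labBlock u) + 3 * k * (labCopy u) + pairIdx k (labLab u) (s.val - 3 * k)) / (3 * k) = 2 ^ (labBlock u) + (labCopy u) := by
      rw [show 3 * k * 2 ^ (labBlock u) + 3 * k * (labCopy u) + pairIdx k (labLab u) (s.val - 3 * k) =
          pairIdx k (labLab u) (s.val - 3 * k) + 3 * k * (2 ^ (labBlock u) + (labCopy u)) by ring,
        Nat.add_mul_div_left _ _ (by omega), Nat.div_eq_of_lt hi, zero_add]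
    have hlog : Nat.log 2 (2 ^ (labBlock u) + (labCopy u)) = (labBlock u) :=
      Nat.log_eq_of_pow_le_of_lt_pow (by omega) (by rw [pow_succ]; omega)
    rw [hdiv, hlog]
    omega

/-! ## §2 The datum -/

variable {σ : Type*}

/-- **The gadget tableau datum** on an enumeration `x : ℕ → σ` of the letters (largest first).
[folklore] -/
def gadgetTab (k c : ℕ) (hk : 1 ≤ k) (hc : 1 ≤ c) (x : ℕ → σ) : TabM σ where
  C := 3 * k * 2 ^ c
  d := 3 * (2 ^ c - 1)
  m := 5 * k
  h n := colHeight k c n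
  var _ r := x r
  box u s := ⟨⟨(boxColRow k c u s).1, (boxColRow_lt k c hk hc u s).1⟩,
    ⟨(boxColRow k c u s).2, (boxColRow_lt k c hk hc u s).2⟩⟩

/-! ## §3 Heights and letter positions -/

/-- Heights are at most `3c`. [folklore] -/
theorem colHeight_le (k c n : ℕ) : colHeight k c n ≤ 3 * c := by
  unfold colHeight; split_ifs <;> omega

/-- The first typed column (`n = 3k`) has height `3c - 1`. [folklore] -/
theorem colHeight_threeK (k c : ℕ) (hk : 1 ≤ k) : colHeight k c (3 * k) = 3 * c - 1 := by
  unfold colHeight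
  rw [if_neg (lt_irrefl _), Nat.div_self (by omega), Nat.log_one_right]
  omega

/-- Every column has positive height (`c ≥ 1`, `n < 3k·2^c`). [folklore] -/
theorem colHeight_pos (k c n : ℕ) (hk : 1 ≤ k) (hc : 1 ≤ c) (hn : n < 3 * k * 2 ^ c) :
    0 < colHeight k c n := by
  unfold colHeight
  split_ifs with h
  · omega
  · have hdiv : n / (3 * k) < 2 ^ c := by
      rw [Nat.div_lt_iff_lt_mul (by omega)]; linarith [hn]
    have hlog : Nat.log 2 (n / (3 * k)) < c := by
      rcases Nat.eq_zero_or_pos (n / (3 * k)) with h0 | hpos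
      · rw [h0, Nat.log_zero_right]; omega
      · exact (Nat.log_lt_iff_lt_pow (by norm_num) hpos.ne').mpr hdiv
    omega

/-- Positions of the block letters, in the form used by the canonical gadget. [folklore] -/
theorem letterPos_two (c : ℕ) (j : ℕ) : letterPos c j 2 = if j = 0 then 0 else 3 * j - 1 := by
  simp [letterPos]

/-- Positions of the block letters, in the form used by the canonical gadget. [folklore] -/
theorem letterPos_one (c : ℕ) (j : ℕ) : letterPos c j 1 = 3 * j + 1 := by
  simp [letterPos]

/-- Positions of the block letters, in the form used by the canonical gadget. [folklore] -/
theorem letterPos_zero (c : ℕ) (j : ℕ) : letterPos c j 0 = if j = c - 1 then 3 * c - 1 else 3 * j + 3 := by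
  simp [letterPos]

end

end Summit.ValiantsHypothesis.ValiantsHypothesis.Theorems.GeneratorObstructions.PowGenDegreeQP
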